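import Summits.QuantumFields.BalabanUV.T4Continuum.Support.NE7CovariantConstancyBox
import Summits.QuantumFields.BalabanUV.T4Continuum.Support.NE7NearStabiliserTorus
import Summits.QuantumFields.BalabanUV.T4Continuum.Support.UnitaryRootInterpolation
import HarnessLib

/-!
# NE7SliceGaugeLetters — LETTERS FOR THE QUADRATIC GROWTH ON THE GAUGE SLICE (ROAD-G114 §9 (S4)): (a) a periodic stabiliser `s` of a unitary configuration has
# `‖s(x) − 1‖` independent of `x` (covariant constancy along bonds + unitary invariance of the norm + lattice propagation); (b) hence a gauge `g` with `g(0) = 1` within `δ` of a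
# stabiliser is within `2δ` of `1` everywhere; (c) a unitary periodic gauge within `δ ≤ 1∕4` of `1` is `exp` of the skew box field `ζ = mlog ∘ g ∘ boxVec`, `‖ζ(r)‖ ≤ 2δ`,
# with `ζ = 0` at the sites where `g = 1`

Cell `pub-balaban`, rung (B)+1 sub-cell t4, lineage `b2b-balaban-t4-ne7-p1` (CRUX PROVER NE7 #1 = OWNER of BINDER row NE7), generation 114.  Memo `t4/b2b-balaban-t4-ne7-p1-g114/ROAD-G114.md` §9.
WHAT ([folklore]; 0 def, 0 sorry).  `norm_stab_sub_one_eq`, `norm_sub_one_le_of_near_stab`, `gauge_log_box`, `gauge_log_box_eq_zero`.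
HONEST FRAMING (page 1): elementary lattice∕Banach-algebra letters; nothing of Bałaban's; NOT NE7, NOT NE3; spine 0∕9; finite T⁴ rung (B)+1 — NOT infinite volume, NOT mass gap, NOT
BetaPertH, NOT Clay.
-/

set_option autoImplicit false

open scoped BigOperators Matrix Matrix.Norms.L2Operator
open NormedSpace Finset Set

namespace Summit.QuantumFields.BalabanUV.T4Continuum.NE7SliceGaugeLetters

open Literature.MathematicalPhysics.QuantumFieldTheory.Balaban1983to89
open B7Prop1Explicit B7Prop2Explicit MatrixLog
open T4AveragingDeficitWall (IsUnitaryCfg)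
open AveragingDeficitTorusChart (redN)
open NE3EnergyShapes (IsUnitarySite IsPeriodicSite)
open NE7DatumCoordinateStabiliser (inv_mem_unitary)
open NE7CovariantConstancyBox (eq_zero_of_propagate)
open NE7NearStabiliserTorus (site_eq_wrap)

noncomputable section

variable {n : Type} [Fintype n] [DecidableEq n] {d : ℕ}

/-- **(a)** A periodic stabiliser `s` of a unitary configuration `U` (`s·U = U`) has `‖s(x) − 1‖ = ‖s(0) − 1‖` for every site `x`. [folklore] -/
theorem norm_stab_sub_one_eq [Nonempty n] {M : ℕ} [NeZero M] {U : Site d → Fin d → (Matrix n n ℂ)ˣ} (hU : IsUnitaryCfg U)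
    {s : Site d → (Matrix n n ℂ)ˣ} (hsP : IsPeriodicSite s (M : ℤ)) (hfix : gaugeAct s U = U) (x : Site d) :
    ‖(s x : Matrix n n ℂ) - 1‖ = ‖(s 0 : Matrix n n ℂ) - 1‖ := by
  letI : CStarAlgebra (Matrix n n ℂ) := {}
  have hstep : ∀ (y : Site d) (κ : Fin d), ‖(s (y + e κ) : Matrix n n ℂ) - 1‖ = ‖(s y : Matrix n n ℂ) - 1‖ := by
    intro y κ
    have h := congr_fun (congr_fun hfix y) κ
    simp only [gaugeAct] at h
    have h3 : s (y + e κ) = (U y κ)⁻¹ * s y * U y κ := by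
      calc s (y + e κ) = (s y * U y κ * (s (y + e κ))⁻¹)⁻¹ * s y * U y κ := by group
        _ = (U y κ)⁻¹ * s y * U y κ := by rw [h]
    have e1 : (s (y + e κ) : Matrix n n ℂ) - 1 = (((U y κ)⁻¹ : (Matrix n n ℂ)ˣ) : Matrix n n ℂ) * ((s y : Matrix n n ℂ) - 1) * (U y κ : Matrix n n ℂ) := by
      rw [h3, Units.val_mul, Units.val_mul, mul_sub, sub_mul, mul_one, Units.inv_mul]
    rw [e1, CStarRing.norm_mul_mem_unitary _ (mem_unitaryUnits.mp (hU y κ)), CStarRing.norm_mem_unitary_mul _ (inv_mem_unitary (hU y κ))]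
  have hbox : ∀ r : Fin d → Fin M, ‖(s (boxVec M r) : Matrix n n ℂ) - 1‖ = ‖(s 0 : Matrix n n ℂ) - 1‖ := by
    refine eq_zero_of_propagate M (P := fun r => ‖(s (boxVec M r) : Matrix n n ℂ) - 1‖ = ‖(s 0 : Matrix n n ℂ) - 1‖) ?_ ?_
    · have h0 : boxVec M (fun _ : Fin d => (⟨0, Nat.pos_of_ne_zero (NeZero.ne M)⟩ : Fin M)) = (0 : Site d) := by
        funext i; simp [boxVec]
      rw [h0]
    · intro r i hr
      rw [← site_eq_wrap hsP (boxVec M r + e i), hstep, hr]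
  rw [site_eq_wrap hsP x]
  exact hbox _

/-- **(b)** A gauge `g` with `g(0) = 1` within `δ` of a periodic stabiliser of a unitary configuration is within `2δ` of `1` everywhere. [folklore] -/
theorem norm_sub_one_le_of_near_stab [Nonempty n] {M : ℕ} [NeZero M] {U : Site d → Fin d → (Matrix n n ℂ)ˣ} (hU : IsUnitaryCfg U)
    {s g : Site d → (Matrix n n ℂ)ˣ} (hsP : IsPeriodicSite s (M : ℤ)) (hfix : gaugeAct s U = U) (hg0 : g 0 = 1) {δ : ℝ}
    (hgs : ∀ x, ‖(g x : Matrix n n ℂ) - (s x : Matrix n n ℂ)‖ ≤ δ) (x : Site d) : ‖(g x : Matrix n n ℂ) - 1‖ ≤ 2 * δ := by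
  have h1 : ‖(s x : Matrix n n ℂ) - 1‖ ≤ δ := by
    rw [norm_stab_sub_one_eq hU hsP hfix x, ← norm_neg, neg_sub]
    have h := hgs 0
    rwa [hg0, Units.val_one] at h
  calc ‖(g x : Matrix n n ℂ) - 1‖ = ‖((g x : Matrix n n ℂ) - (s x : Matrix n n ℂ)) + ((s x : Matrix n n ℂ) - 1)‖ := by rw [sub_add_sub_cancel]
    _ ≤ ‖(g x : Matrix n n ℂ) - (s x : Matrix n n ℂ)‖ + ‖(s x : Matrix n n ℂ) - 1‖ := norm_add_le _ _
    _ ≤ 2 * δ := by linarith [hgs x]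

/-- **(c)** A unitary `M`-periodic gauge within `δ ≤ 1∕4` of `1` is `exp` of the skew box field `ζ(r) = mlog g(boxVec r)`, with `‖ζ(r)‖ ≤ 2δ`. [folklore] -/
theorem gauge_log_box [Nonempty n] {M : ℕ} [NeZero M] {g : Site d → (Matrix n n ℂ)ˣ} (hgu : IsUnitarySite g) (hgP : IsPeriodicSite g (M : ℤ))
    {δ : ℝ} (hδ : δ ≤ 1 / 4) (hg1 : ∀ x, ‖(g x : Matrix n n ℂ) - 1‖ ≤ δ) :
    (∀ r : Fin d → Fin M, mlog (g (boxVec M r) : Matrix n n ℂ) ∈ skewAdjoint (Matrix n n ℂ)) ∧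
    (∀ r : Fin d → Fin M, ‖mlog (g (boxVec M r) : Matrix n n ℂ)‖ ≤ 2 * δ) ∧
    (fun x : Site d => expUnit (mlog (g (boxVec M (redN M x)) : Matrix n n ℂ))) = g := by
  letI : NormedAlgebra ℚ (Matrix n n ℂ) := NormedAlgebra.restrictScalars ℚ ℂ (Matrix n n ℂ)
  letI : CStarAlgebra (Matrix n n ℂ) := {}
  refine ⟨fun r => ?_, fun r => ?_, ?_⟩
  · have h := UnitaryRootInterpolation.smul_mlog_mem_skewAdjoint (R := (g (boxVec M r) : Matrix n n ℂ)) (mem_unitaryUnits.mp (hgu (boxVec M r)))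
      ((hg1 (boxVec M r)).trans hδ) 1
    rwa [one_smul] at h
  · exact (norm_mlog_le_two_mul ((hg1 _).trans (hδ.trans (by norm_num)))).trans (by linarith [hg1 (boxVec M r)])
  · funext x
    apply Units.ext
    rw [val_expUnit, exp_mlog ((hg1 _).trans_lt (hδ.trans_lt (by norm_num))), ← site_eq_wrap hgP x]

/-- **(c′)** … and `ζ` vanishes at (the reductions of) the sites where `g = 1`. [folklore] -/
theorem gauge_log_box_eq_zero {M : ℕ} [NeZero M] {g : Site d → (Matrix n n ℂ)ˣ} (hgP : IsPeriodicSite g (M : ℤ)) {y : Site d} (hy : g y = 1) :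
    mlog (g (boxVec M (redN M y)) : Matrix n n ℂ) = 0 := by
  rw [← site_eq_wrap hgP y, hy, Units.val_one]
  exact AveragingDeficitChartCalculus.mlog_one

end

end Summit.QuantumFields.BalabanUV.T4Continuum.NE7SliceGaugeLetters
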